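import Mathlib
import HarnessLib
import Summits.QuantumFields.YangMills.Theorems.ComplexCouplingChannelContinuumLegGivenGapProductToUniformGlue
import Summits.QuantumFields.YangMills.Theorems.ComplexCouplingChannelContinuumLegGivenGapProductToUniformLocalBound
import Summits.QuantumFields.YangMills.Theorems.ComplexCouplingChannelContinuumLegGivenGapPtuAssemblyLevel
import Summits.QuantumFields.YangMills.Theorems.ComplexCouplingChannelContinuumLegGivenGapPtuAssemblyNearOut

/-!
# `ContinuumLegGivenGap` (stmt-QuantumFields-15828), line `alternating-curvature-arrays`: `stub_ptuAssembly` — the product bound on tensor test functions gives (UUVB), given the three pieces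

The registered stub `stub_ptuAssembly : (GEOMETRY) → (DERIVATIVES) → (ANALYSIS) → ∀ G r sch, PolyVolumeGrowth sch →
ProductBound r sch → UUVB r sch` of the sub-skeleton of `stub_productToUniform` (tree skeleton §3c).  Proof
(`ptuAsm_uniform`, the k-uniform bound at a fixed step, then the eventuality):
* `p = 0`: `‖·‖ ≤ |F|₀` (`ptu_norm_canonDistribution_zero_le`); `p = 1`: the exactly centred one-point function vanishes
  (`ptu_canonDistribution_one_eq_zero`);
* `p ≥ 2`: the lattice decomposition `ptu_canonDistribution_decomp` (normaliser `W ≥ 1` by the coverage clause of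
  GEOMETRY, `χ̃ = 1` on `supp χ`, temperate growth of the weights from DERIVATIVES) into NEAR + OUTER + ∑ₘ ∑_(v,z) FAR;
  NEAR by `ptuNO_near_le`, OUTER by `ptuNO_out_le` (seam bound of ANALYSIS), every Whitney level by `ptuLevel_sum_le`
  (engine `localBound_of_productBound` with the inner clause of (PB), flat/decay bound of ANALYSIS, bounds of DERIVATIVES,
  geometry and counting of GEOMETRY), the levels summed by `∑ₘ min(ℓₘ, ℓₘ⁻¹) ≤ 3` (`ptuKit_level_sum_le`), and the three
  contributions merged by `ptuKit_shape_add_three` into `Ω^(p+1) (p+1)^(E(p+1)) |F|_(p s')`;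
* finally `ptuKit_shape_le_factorial` turns this into `α (p!)^β |F|_(p s')` eventually in `k` (`a_k ≤ 1`, `L_k ≥ 1` and
  the volume-growth clause hold eventually). [folklore]
-/

set_option autoImplicit false

noncomputable section

open scoped Classical

namespace Summit.QuantumFields.YangMills.Theorems.ContinuumLegGivenGap

open scoped SchwartzMap BigOperators ContDiff
open MeasureTheory Filter Topology
open Literature.MathematicalPhysics.QuantumFieldTheory Literature.MathematicalPhysics.QuantumLattice
  Literature.MathematicalPhysics.AQFT
open Literature.Probability.LatticeModels (box Site)
open Summit.QuantumFields.YangMills.Cruxes.ContinuumLimitOnTrajectory.TwoOrbitSynchronisation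
  (PlaqIdx plaq canonDistribution UUVB PolyVolumeGrowth)
open Summit.QuantumFields.YangMills.Theorems.ContinuumLimitExists.Negative (obsOf centredMoment)
open Summit.QuantumFields.YangMills.Theorems.ContinuumLegGivenGap.AlternatingArrays

/-! ## §1 The k-uniform bound at a fixed step -/

section Uniform

variable {G : Type} [Group G] [TopologicalSpace G] [IsTopologicalGroup G] [CompactSpace G]
  [MeasurableSpace G] [BorelSpace G]

/-- Temperate growth of the complexified weight of a far piece (smooth with compact support). [folklore] -/
theorem ptuAsm_weight_hasTemperateGrowth {a : ℝ} {L p m : ℕ} {v : Fin 4 → ℤ} {z : Fin p → Fin 4 → ℤ}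
    (hC : ContDiff ℝ ∞ (ptuWeight a L p m v z)) (hK : HasCompactSupport (ptuWeight a L p m v z)) :
    (fun y : (Fin p → EuclideanSpace ℝ (Fin 4)) => ((ptuWeight a L p m v z y : ℝ) : ℂ)).HasTemperateGrowth :=
  (show HasCompactSupport (fun y : (Fin p → EuclideanSpace ℝ (Fin 4)) => ((ptuWeight a L p m v z y : ℝ) : ℂ)) from
    hK.comp_left (g := Complex.ofReal) Complex.ofReal_zero).hasTemperateGrowth
    (Complex.ofRealCLM.contDiff.comp hC)

set_option maxHeartbeats 2000000 in
/-- **The k-uniform bound.**  Given the three pieces, the constants `C, p₀, s, k₀` of (PB) and the volume-growth exponent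
`N₁`, there are `s', Ω ≥ 1, E` with: at every step `k ≥ k₀` with `L_k ≥ 1`, `a_k ≤ 1`, `a_k⁻¹ ≤ (a_k L_k)^N₁`, for all
`p, q` and off-diagonal `F`, `‖T_k(F)‖ ≤ Ω^(p+1) (p+1)^(E(p+1)) |F|_(p s')`. [folklore] -/
theorem ptuAsm_uniform
    (hGeo : ∃ c : ℝ, 0 < c ∧ ∀ (a : ℝ) (L p : ℕ), 0 < a → IsTriadic L → 1 ≤ L → 2 ≤ p →
      (∀ y : (Fin p → EuclideanSpace ℝ (Fin 4)), 1 ≤ ptuW a L p y) ∧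
      (∀ y : (Fin p → EuclideanSpace ℝ (Fin 4)), 0 ≤ ptuNear a p y ∧ ptuNear a p y ≤ 1) ∧
      (∀ y : (Fin p → EuclideanSpace ℝ (Fin 4)), 0 ≤ ptuOut a L p y ∧ ptuOut a L p y ≤ 1) ∧
      (∀ (m : ℕ) (v : Fin 4 → ℤ) (z : Fin p → Fin 4 → ℤ) (y : (Fin p → EuclideanSpace ℝ (Fin 4))),
        0 ≤ ptuPhiStar a m p v z y ∧ ptuPhiStar a m p v z y ≤ 1) ∧
      (∀ y : (Fin p → EuclideanSpace ℝ (Fin 4)), ptuNear a p y ≠ 0 →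
        ∃ i j : Fin p, i ≠ j ∧ ∀ μ : Fin 4, |y i μ - y j μ| < (ptuR p : ℝ) * a) ∧
      (∀ y : (Fin p → EuclideanSpace ℝ (Fin 4)), ptuOut a L p y ≠ 0 → ∃ (i : Fin p) (μ : Fin 4), a * (L : ℝ) / 8 < |y i μ|) ∧
      (∀ m ∈ ptuLevels L p, LevelAdmissible L m ∧ ptuM0 p ≤ m ∧ 32 ≤ ptuD m p ∧
        ∀ vz ∈ ptuIdx L m p,
          (∀ i : Fin p, CellInHalfBox L m vz.1 (vz.2 i)) ∧ Function.Injective vz.2 ∧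
          (∀ i : Fin p, tsupport (ptuChiFun a m p vz.1 (vz.2 i)) ⊆ physCore a m vz.1 (vz.2 i)) ∧
          (∀ (i : Fin p) (u : EuclideanSpace ℝ (Fin 4)), u ∈ tsupport (ptuChiFun a m p vz.1 (vz.2 i)) →
            ptuChiTildeFun a m p vz.1 (vz.2 i) u = 1) ∧
          (∀ y : (Fin p → EuclideanSpace ℝ (Fin 4)), y ∈ tsupport (ptuPhiTilde a m p vz.1 vz.2) →
            (∃ i j : Fin p, i ≠ j ∧ ‖y i - y j‖ ≤ 240 * (a * cellSide m)) ∧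
            ∀ (i : Fin p) (μ : Fin 4), a * ((vz.1 μ : ℝ) + cellSide m * (vz.2 i μ : ℝ)) ≤ y i μ ∧
              y i μ ≤ a * ((vz.1 μ : ℝ) + cellSide m * ((vz.2 i μ : ℝ) + 1)))) ∧
      (∀ m ∈ ptuLevels L p, ∀ g : (Fin 4 → ℤ) × (Fin p → Fin 4 → ℤ) → (Fin p → EuclideanSpace ℝ (Fin 4)),
        (∀ vz ∈ ptuIdx L m p, ∀ (i : Fin p) (μ : Fin 4),
          a * ((vz.1 μ : ℝ) + cellSide m * (vz.2 i μ : ℝ)) ≤ g vz i μ ∧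
            g vz i μ ≤ a * ((vz.1 μ : ℝ) + cellSide m * ((vz.2 i μ : ℝ) + 1))) →
        ∑ vz ∈ ptuIdx L m p, (((1 + ‖g vz‖) ^ 6)⁻¹) ^ p ≤
          (2 * (p : ℝ) + 1) ^ 4 * (c * max 1 ((a * cellSide m)⁻¹ ^ 4)) ^ p))
    (hDer : ∃ c : ℝ, 0 < c ∧ ∀ (a : ℝ) (L p : ℕ), 0 < a → IsTriadic L → 1 ≤ L → 2 ≤ p →
      (∀ y : (Fin p → EuclideanSpace ℝ (Fin 4)), 1 ≤ ptuW a L p y) →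
      ContDiff ℝ ∞ (ptuW a L p) ∧
      ∀ m ∈ ptuLevels L p, ∀ vz ∈ ptuIdx L m p,
        ContDiff ℝ ∞ (ptuWeight a L p m vz.1 vz.2) ∧ HasCompactSupport (ptuWeight a L p m vz.1 vz.2) ∧
        tsupport (ptuWeight a L p m vz.1 vz.2) ⊆ tsupport (ptuPhiTilde a m p vz.1 vz.2) ∧
        (∀ (i : Fin p) (j : ℕ) (u : EuclideanSpace ℝ (Fin 4)),
          (a * cellSide m) ^ j * ‖iteratedFDeriv ℝ j (ptuChiFun a m p vz.1 (vz.2 i)) u‖ ≤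
            c * (c * ((p : ℝ) + 1) * ((j : ℝ) + 1) ^ 4) ^ j) ∧
        (∀ (n : ℕ) (y : (Fin p → EuclideanSpace ℝ (Fin 4))),
          ‖iteratedFDeriv ℝ n (ptuWeight a L p m vz.1 vz.2) y‖ ≤
            c * (c * ((p : ℝ) + 1) ^ 8 * ((n : ℝ) + 1) ^ 8 / (a * cellSide m)) ^ n))
    (hAna : (∀ (p n M K : ℕ) (F : 𝓢((Fin p → EuclideanSpace ℝ (Fin 4)), ℂ)), IsOffDiagonal F →
        ∀ (w : (Fin p → EuclideanSpace ℝ (Fin 4)) → ℝ) (A D δ d : ℝ), ContDiff ℝ ∞ w → HasCompactSupport w →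
          0 ≤ A → 0 ≤ D → 0 ≤ δ → 0 ≤ d →
          (∀ i ≤ n, ∀ y : (Fin p → EuclideanSpace ℝ (Fin 4)), ‖iteratedFDeriv ℝ i w y‖ ≤ A * D ^ i) →
          (∀ y ∈ tsupport w, ∃ i j : Fin p, i ≠ j ∧ ‖y i - y j‖ ≤ δ) →
          (∀ y ∈ tsupport w, d ≤ ‖y‖) →
          schwartzNorm n (SchwartzMap.smulLeftCLM ℂ (fun y : (Fin p → EuclideanSpace ℝ (Fin 4)) => ((w y : ℝ) : ℂ)) F) ≤
            A * (2 * max 1 D) ^ n * 2 ^ (K + 1) * δ ^ M * ((1 + d) ^ K)⁻¹ * schwartzNorm (n + M + K) F) ∧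
      (∃ c : ℝ, 0 < c ∧ ∀ (N p : ℕ) (a : ℝ) (L : ℕ) (F : 𝓢((Fin p → EuclideanSpace ℝ (Fin 4)), ℂ)),
        0 < a → a ≤ 1 → a⁻¹ ≤ (a * L) ^ N →
        ∑ x ∈ (Finset.univ : Finset (Fin p → ↥(box 4 L))).filter
            (fun x => ∃ (i : Fin p) (μ : Fin 4), (L : ℝ) < 8 * |(((x i : Site 4) μ : ℤ) : ℝ)|),
          ‖F (fun i => a • siteToE (↑(x i) : Site 4))‖ ≤
          (c * 2 ^ (16 * N)) ^ (p + 1) * schwartzNorm (p * (4 * N + 6)) F))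
    (r : LatticeRep G) (sch : SpeciesScheme (YMSpecies G)) {N₁ : ℕ} {C : ℝ} {p₀ s k₀ : ℕ} (hC : 0 ≤ C)
    (hPBk : ∀ k : ℕ, k₀ ≤ k → IsTriadic (sch.L k) ∧
      ∀ (n m : ℕ) (v : Fin 4 → ℤ) (q : Fin n → PlaqIdx) (z : Fin n → (Fin 4 → ℤ)) (f : Fin n → 𝓢(EuclideanSpace ℝ (Fin 4), ℝ))
        (F : 𝓢((Fin n → EuclideanSpace ℝ (Fin 4)), ℂ)),
        LevelAdmissible (sch.L k) m → (∀ i, CellInHalfBox (sch.L k) m v (z i)) → Function.Injective z →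
        (∀ i, tsupport (f i) ⊆ physCore (sch.a k) m v (z i)) → IsTensorOf F (fun i => ofRealTest (f i)) →
        ‖canonDistribution r sch k n (fun i => plaq r (q i)) F‖ ≤
          ∏ i, C * max (sch.a k * cellSide m) (sch.a k * cellSide m)⁻¹ ^ p₀ * cellNorm s (sch.a k * cellSide m) (f i)) :
    ∃ (s' : ℕ) (Ω : ℝ) (E : ℕ), 1 ≤ Ω ∧ ∀ k : ℕ, k₀ ≤ k → 1 ≤ sch.L k → sch.a k ≤ 1 →
      (sch.a k)⁻¹ ≤ (sch.a k * (sch.L k : ℝ)) ^ N₁ →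
      ∀ (p : ℕ) (q : Fin p → PlaqIdx) (F : 𝓢((Fin p → EuclideanSpace ℝ (Fin 4)), ℂ)), IsOffDiagonal F →
        ‖canonDistribution r sch k p (fun i => plaq r (q i)) F‖ ≤
          Ω ^ (p + 1) * ((p : ℝ) + 1) ^ (E * (p + 1)) * schwartzNorm (p * s') F := by
  obtain ⟨c₁, hc₁, hG⟩ := hGeo
  obtain ⟨c₂, hc₂, hD⟩ := hDer
  obtain ⟨hFlat, c₃, hc₃, hSeam⟩ := hAna
  obtain ⟨t, K, hK, hLB⟩ := localBound_of_productBound s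
  -- the three constants
  have hΩ₁0 : (0 : ℝ) ≤ (162 * max c₂ 1 + (2 * C * K * (((s : ℝ) + 1) * 2 ^ s) * max c₂ 1 ^ (s + 1) * ((s : ℝ) + 1) ^ (4 * s)) * (2 * max c₂ 1 * ((t : ℝ) + 1) ^ 8) ^ t * 2 ^ (p₀ + s + 8) * (240 : ℝ) ^ (p₀ + t + s + 6) * max c₁ 1) := by
    have h1 : (0 : ℝ) ≤ max c₂ 1 := le_trans zero_le_one (le_max_right _ _)
    have h2 : (0 : ℝ) ≤ max c₁ 1 := le_trans zero_le_one (le_max_right _ _)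
    positivity
  generalize hΩ₁ : (162 * max c₂ 1 + (2 * C * K * (((s : ℝ) + 1) * 2 ^ s) * max c₂ 1 ^ (s + 1) * ((s : ℝ) + 1) ^ (4 * s)) * (2 * max c₂ 1 * ((t : ℝ) + 1) ^ 8) ^ t * 2 ^ (p₀ + s + 8) * (240 : ℝ) ^ (p₀ + t + s + 6) * max c₁ 1) = Ω₁ at hΩ₁0
  have hK0 : (0 : ℝ) ≤ (81 * ∑' m : ℕ, (((m : ℝ) + 1) ^ 2)⁻¹) := mul_nonneg (by norm_num) (tsum_nonneg fun m => by positivity)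
  have hΩ₂2 : (2 : ℝ) ≤ (2 + 12 * (r.N : ℝ) * (1024 * (81 * ∑' m : ℕ, (((m : ℝ) + 1) ^ 2)⁻¹) * 13824 ^ 4)) := by
    have h : (0 : ℝ) ≤ 12 * (r.N : ℝ) * (1024 * (81 * ∑' m : ℕ, (((m : ℝ) + 1) ^ 2)⁻¹) * 13824 ^ 4) := by positivity
    linarith
  have hΩ₃0 : (0 : ℝ) ≤ ((12 * (r.N : ℝ) + 1) * (c₃ * 2 ^ (16 * N₁))) := by positivity
  refine ⟨4 * N₁ + 2 * t + p₀ + s + 12, 3 * ((2 + 12 * (r.N : ℝ) * (1024 * (81 * ∑' m : ℕ, (((m : ℝ) + 1) ^ 2)⁻¹) * 13824 ^ 4)) + ((12 * (r.N : ℝ) + 1) * (c₃ * 2 ^ (16 * N₁))) + 3 * Ω₁), (s + 16 * t + 4) + 4,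
    by linarith, ?_⟩
  intro k hk hL1 ha1 hpvg p q F hF
  have ha : 0 < sch.a k := sch.a_pos k
  obtain ⟨hTri, hPBin⟩ := hPBk k hk
  generalize hΩ₂ : (2 + 12 * (r.N : ℝ) * (1024 * (81 * ∑' m : ℕ, (((m : ℝ) + 1) ^ 2)⁻¹) * 13824 ^ 4)) = Ω₂ at hΩ₂2 ⊢
  generalize hΩ₃ : ((12 * (r.N : ℝ) + 1) * (c₃ * 2 ^ (16 * N₁))) = Ω₃ at hΩ₃0 ⊢
  have hΩ₂0 : 0 ≤ Ω₂ := by linarith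
  have hΩ1 : (1 : ℝ) ≤ 3 * (Ω₂ + Ω₃ + 3 * Ω₁) := by nlinarith
  have hp1 : (1 : ℝ) ≤ (p : ℝ) + 1 := by linarith [(Nat.cast_nonneg p : (0 : ℝ) ≤ p)]
  have hsN : 0 ≤ schwartzNorm (p * (4 * N₁ + 2 * t + p₀ + s + 12)) F := schwartzNorm_nonneg _ _
  have hRHS1 : schwartzNorm (p * (4 * N₁ + 2 * t + p₀ + s + 12)) F ≤
      (3 * (Ω₂ + Ω₃ + 3 * Ω₁)) ^ (p + 1) * ((p : ℝ) + 1) ^ ((s + 16 * t + 4 + 4) * (p + 1)) *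
        schwartzNorm (p * (4 * N₁ + 2 * t + p₀ + s + 12)) F :=
    le_mul_of_one_le_left hsN (one_le_mul_of_one_le_of_one_le (one_le_pow₀ hΩ1) (one_le_pow₀ hp1))
  rcases Nat.lt_or_ge p 2 with hp2 | hp2
  · interval_cases p
    · calc ‖canonDistribution r sch k 0 (fun i => plaq r (q i)) F‖ ≤ schwartzNorm 0 F :=
            ptu_norm_canonDistribution_zero_le r sch k q F
        _ = schwartzNorm (0 * (4 * N₁ + 2 * t + p₀ + s + 12)) F := by rw [Nat.zero_mul]
        _ ≤ _ := hRHS1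
    · rw [ptu_canonDistribution_one_eq_zero, norm_zero]
      exact hsN.trans hRHS1
  -- `p ≥ 2`: the Whitney decomposition
  obtain ⟨hW1, hN01, hO01, -, hcritN, hcritO, hlev, hcnt⟩ := hG (sch.a k) (sch.L k) p ha hTri hL1 hp2
  obtain ⟨-, hpieces⟩ := hD (sch.a k) (sch.L k) p ha hTri hL1 hp2 hW1
  have hWne : ∀ x : Fin p → ↥(box 4 (sch.L k)),
      ptuW (sch.a k) (sch.L k) p (fun i => sch.a k • siteToE (↑(x i) : Site 4)) ≠ 0 :=
    fun x => (lt_of_lt_of_le one_pos (hW1 _)).ne'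
  have hχ1 : ∀ m ∈ ptuLevels (sch.L k) p, ∀ vz ∈ ptuIdx (sch.L k) m p, ∀ (i : Fin p) (u : EuclideanSpace ℝ (Fin 4)),
      ptuChiFun (sch.a k) m p vz.1 (vz.2 i) u ≠ 0 → ptuChiTildeFun (sch.a k) m p vz.1 (vz.2 i) u = 1 :=
    fun m hm vz hvz i u hu => ((hlev m hm).2.2.2 vz hvz).2.2.2.1 i u (subset_tsupport _ hu)
  have hT : ∀ m ∈ ptuLevels (sch.L k) p, ∀ vz ∈ ptuIdx (sch.L k) m p,
      (fun y : (Fin p → EuclideanSpace ℝ (Fin 4)) => ((ptuWeight (sch.a k) (sch.L k) p m vz.1 vz.2 y : ℝ) : ℂ)).HasTemperateGrowth :=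
    fun m hm vz hvz => ptuAsm_weight_hasTemperateGrowth (hpieces m hm vz hvz).1 (hpieces m hm vz hvz).2.1
  have hdec := ptu_canonDistribution_decomp r sch k p q F hWne hχ1 hT
  -- NEAR and OUTER
  have hNear := ptuNO_near_le G r sch k p q F hF ha1 hN01 hW1 hcritN
  have hOut := ptuNO_out_le r sch k p q F hc₃ ha1 hpvg hO01 hW1 hcritO hSeam
  rw [hΩ₂] at hNear
  rw [hΩ₃] at hOut
  -- FAR, level by level
  have hFar : ∀ m ∈ ptuLevels (sch.L k) p,
      ‖∑ vz ∈ ptuIdx (sch.L k) m p, ∑ x : Fin p → ↥(box 4 (sch.L k)),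
            (∏ i, ((ptuChi (sch.a k) m p vz.1 (vz.2 i) (sch.a k • siteToE (↑(x i) : Site 4)) : ℝ) : ℂ)) *
              (SchwartzMap.smulLeftCLM ℂ
                  (fun y : (Fin p → EuclideanSpace ℝ (Fin 4)) => ((ptuWeight (sch.a k) (sch.L k) p m vz.1 vz.2 y : ℝ) : ℂ)) F)
                (fun i => sch.a k • siteToE (↑(x i) : Site 4)) *
              ((centredMoment r (sch.L k) (sch.β k) p (fun i => some (q i)) (fun i => (x i : Site 4)) : ℝ) : ℂ)‖ ≤
        Ω₁ ^ (p + 1) * ((p : ℝ) + 1) ^ ((s + 16 * t + 4) * (p + 1)) *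
          min (sch.a k * cellSide m) (sch.a k * cellSide m)⁻¹ * schwartzNorm (p * (2 * t + p₀ + s + 12)) F := by
    intro m hm
    obtain ⟨hLA, -, -, hidx⟩ := hlev m hm
    refine (norm_sum_le _ _).trans ?_
    rw [← hΩ₁]
    exact ptuLevel_sum_le r sch k p q F hF m hC hK hc₂ hc₁ (by omega) hLB hFlat
      (fun vz hvz f F' hf hF' => hPBin p m vz.1 q vz.2 f F' hLA (hidx vz hvz).1 (hidx vz hvz).2.1 hf hF')
      (fun vz hvz => (hidx vz hvz).2.2.1)
      (fun vz hvz => (hpieces m hm vz hvz).2.2.2.1)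
      (fun vz hvz => (hpieces m hm vz hvz).1)
      (fun vz hvz => (hpieces m hm vz hvz).2.1)
      (fun vz hvz => (hpieces m hm vz hvz).2.2.1)
      (fun vz hvz => (hpieces m hm vz hvz).2.2.2.2)
      (fun vz hvz => (hidx vz hvz).2.2.2.2)
      (fun vz hvz => by
        obtain ⟨i, j, hij, -⟩ := (Finset.mem_filter.1 hvz).2.2.2
        exact ⟨i, j, hij, (Finset.mem_filter.1 hvz).2.2.1 i j hij⟩)
      (hcnt m hm)
  have hFarSum : ‖∑ m ∈ ptuLevels (sch.L k) p, ∑ vz ∈ ptuIdx (sch.L k) m p, ∑ x : Fin p → ↥(box 4 (sch.L k)),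
            (∏ i, ((ptuChi (sch.a k) m p vz.1 (vz.2 i) (sch.a k • siteToE (↑(x i) : Site 4)) : ℝ) : ℂ)) *
              (SchwartzMap.smulLeftCLM ℂ
                  (fun y : (Fin p → EuclideanSpace ℝ (Fin 4)) => ((ptuWeight (sch.a k) (sch.L k) p m vz.1 vz.2 y : ℝ) : ℂ)) F)
                (fun i => sch.a k • siteToE (↑(x i) : Site 4)) *
              ((centredMoment r (sch.L k) (sch.β k) p (fun i => some (q i)) (fun i => (x i : Site 4)) : ℝ) : ℂ)‖ ≤
      3 * (Ω₁ ^ (p + 1) * ((p : ℝ) + 1) ^ ((s + 16 * t + 4) * (p + 1)) *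
        schwartzNorm (p * (2 * t + p₀ + s + 12)) F) := by
    refine (norm_sum_le _ _).trans ((Finset.sum_le_sum hFar).trans ?_)
    have hsum := ptuKit_level_sum_le ha (ptuLevels (sch.L k) p)
    have hA : 0 ≤ Ω₁ ^ (p + 1) * ((p : ℝ) + 1) ^ ((s + 16 * t + 4) * (p + 1)) *
        schwartzNorm (p * (2 * t + p₀ + s + 12)) F := by
      have := schwartzNorm_nonneg (p * (2 * t + p₀ + s + 12)) F
      positivity
    calc ∑ m ∈ ptuLevels (sch.L k) p, Ω₁ ^ (p + 1) * ((p : ℝ) + 1) ^ ((s + 16 * t + 4) * (p + 1)) *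
          min (sch.a k * cellSide m) (sch.a k * cellSide m)⁻¹ * schwartzNorm (p * (2 * t + p₀ + s + 12)) F
        = (Ω₁ ^ (p + 1) * ((p : ℝ) + 1) ^ ((s + 16 * t + 4) * (p + 1)) *
            schwartzNorm (p * (2 * t + p₀ + s + 12)) F) *
            ∑ m ∈ ptuLevels (sch.L k) p, min (sch.a k * cellSide m) (sch.a k * cellSide m)⁻¹ := by
          rw [Finset.mul_sum]
          exact Finset.sum_congr rfl fun m _ => by ring
      _ ≤ (Ω₁ ^ (p + 1) * ((p : ℝ) + 1) ^ ((s + 16 * t + 4) * (p + 1)) *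
            schwartzNorm (p * (2 * t + p₀ + s + 12)) F) * 3 := mul_le_mul_of_nonneg_left hsum hA
      _ = _ := by ring
  -- Schwartz indices
  have h6 : schwartzNorm (p * 6) F ≤ schwartzNorm (p * (4 * N₁ + 2 * t + p₀ + s + 12)) F :=
    schwartzNorm_mono (Nat.mul_le_mul_left p (by omega)) F
  have hO' : schwartzNorm (p * (4 * N₁ + 6)) F ≤ schwartzNorm (p * (4 * N₁ + 2 * t + p₀ + s + 12)) F :=
    schwartzNorm_mono (Nat.mul_le_mul_left p (by omega)) F
  have hF' : schwartzNorm (p * (2 * t + p₀ + s + 12)) F ≤ schwartzNorm (p * (4 * N₁ + 2 * t + p₀ + s + 12)) F :=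
    schwartzNorm_mono (Nat.mul_le_mul_left p (by omega)) F
  generalize hsNdef : schwartzNorm (p * (4 * N₁ + 2 * t + p₀ + s + 12)) F = sN at hsN hRHS1 h6 hO' hF' ⊢
  -- the three contributions in the common shape
  have h3Ω : (3 : ℝ) * Ω₁ ^ (p + 1) ≤ (3 * Ω₁) ^ (p + 1) := by
    rw [mul_pow]
    refine mul_le_mul_of_nonneg_right ?_ (pow_nonneg hΩ₁0 _)
    calc (3 : ℝ) = 3 ^ 1 := (pow_one _).symm
      _ ≤ 3 ^ (p + 1) := pow_le_pow_right₀ (by norm_num) (by omega)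
  have hshape := ptuKit_shape_add_three (x := Ω₂) (y := Ω₃) (z := 3 * Ω₁) hΩ₂0 hΩ₃0 (by positivity)
    (E₁ := 4) (E₂ := 0) (E₃ := s + 16 * t + 4) (E := s + 16 * t + 4 + 4) (by omega) (by omega) (by omega) p
  rw [hdec]
  calc _ ≤ ‖∑ x : Fin p → ↥(box 4 (sch.L k)),
          ((ptuNear (sch.a k) p (fun i => sch.a k • siteToE (↑(x i) : Site 4)) / ptuW (sch.a k) (sch.L k) p (fun i => sch.a k • siteToE (↑(x i) : Site 4)) : ℝ) : ℂ) * F (fun i => sch.a k • siteToE (↑(x i) : Site 4)) * ((centredMoment r (sch.L k) (sch.β k) p (fun i => some (q i)) (fun i => (x i : Site 4)) : ℝ) : ℂ)‖ +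
        ‖∑ x : Fin p → ↥(box 4 (sch.L k)),
          ((ptuOut (sch.a k) (sch.L k) p (fun i => sch.a k • siteToE (↑(x i) : Site 4)) / ptuW (sch.a k) (sch.L k) p (fun i => sch.a k • siteToE (↑(x i) : Site 4)) : ℝ) : ℂ) * F (fun i => sch.a k • siteToE (↑(x i) : Site 4)) * ((centredMoment r (sch.L k) (sch.β k) p (fun i => some (q i)) (fun i => (x i : Site 4)) : ℝ) : ℂ)‖ +
        ‖∑ m ∈ ptuLevels (sch.L k) p, ∑ vz ∈ ptuIdx (sch.L k) m p, ∑ x : Fin p → ↥(box 4 (sch.L k)),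
            (∏ i, ((ptuChi (sch.a k) m p vz.1 (vz.2 i) (sch.a k • siteToE (↑(x i) : Site 4)) : ℝ) : ℂ)) *
              (SchwartzMap.smulLeftCLM ℂ
                  (fun y : (Fin p → EuclideanSpace ℝ (Fin 4)) => ((ptuWeight (sch.a k) (sch.L k) p m vz.1 vz.2 y : ℝ) : ℂ)) F)
                (fun i => sch.a k • siteToE (↑(x i) : Site 4)) *
              ((centredMoment r (sch.L k) (sch.β k) p (fun i => some (q i)) (fun i => (x i : Site 4)) : ℝ) : ℂ)‖ := norm_add₃_le
    _ ≤ Ω₂ ^ (p + 1) * ((p : ℝ) + 1) ^ (4 * (p + 1)) * schwartzNorm (p * 6) F +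
        Ω₃ ^ (p + 1) * schwartzNorm (p * (4 * N₁ + 6)) F +
        3 * (Ω₁ ^ (p + 1) * ((p : ℝ) + 1) ^ ((s + 16 * t + 4) * (p + 1)) *
          schwartzNorm (p * (2 * t + p₀ + s + 12)) F) := add_le_add_three hNear hOut hFarSum
    _ ≤ Ω₂ ^ (p + 1) * ((p : ℝ) + 1) ^ (4 * (p + 1)) * sN + Ω₃ ^ (p + 1) * ((p : ℝ) + 1) ^ (0 * (p + 1)) * sN +
        (3 * Ω₁) ^ (p + 1) * ((p : ℝ) + 1) ^ ((s + 16 * t + 4) * (p + 1)) * sN := by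
        rw [Nat.zero_mul, pow_zero, mul_one]
        refine add_le_add_three (mul_le_mul_of_nonneg_left h6 (by positivity))
          (mul_le_mul_of_nonneg_left hO' (pow_nonneg hΩ₃0 _)) ?_
        calc 3 * (Ω₁ ^ (p + 1) * ((p : ℝ) + 1) ^ ((s + 16 * t + 4) * (p + 1)) *
              schwartzNorm (p * (2 * t + p₀ + s + 12)) F)
            = (3 * Ω₁ ^ (p + 1)) * ((p : ℝ) + 1) ^ ((s + 16 * t + 4) * (p + 1)) *
              schwartzNorm (p * (2 * t + p₀ + s + 12)) F := by ring
          _ ≤ (3 * Ω₁) ^ (p + 1) * ((p : ℝ) + 1) ^ ((s + 16 * t + 4) * (p + 1)) * sN :=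
              mul_le_mul (mul_le_mul_of_nonneg_right h3Ω (by positivity)) hF' (schwartzNorm_nonneg _ _)
                (by positivity)
    _ = (Ω₂ ^ (p + 1) * ((p : ℝ) + 1) ^ (4 * (p + 1)) + Ω₃ ^ (p + 1) * ((p : ℝ) + 1) ^ (0 * (p + 1)) +
        (3 * Ω₁) ^ (p + 1) * ((p : ℝ) + 1) ^ ((s + 16 * t + 4) * (p + 1))) * sN := by ring
    _ ≤ (3 * (Ω₂ + Ω₃ + 3 * Ω₁)) ^ (p + 1) * ((p : ℝ) + 1) ^ ((s + 16 * t + 4 + 4) * (p + 1)) * sN :=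
        mul_le_mul_of_nonneg_right hshape hsN

end Uniform

/-! ## §2 The registered stub -/

/-- **`stub_ptuAssembly`** (registered stub of the sub-skeleton of `stub_productToUniform`, line
`alternating-curvature-arrays`): the three pieces GEOMETRY, DERIVATIVES, ANALYSIS of the Whitney / grid-shift / nuclear
step imply that polynomial volume growth and the product bound (PB) on tensor test functions give (UUVB). [folklore] -/
theorem stub_ptuAssembly :
    (∃ c : ℝ, 0 < c ∧ ∀ (a : ℝ) (L p : ℕ), 0 < a → IsTriadic L → 1 ≤ L → 2 ≤ p →
      (∀ y : (Fin p → EuclideanSpace ℝ (Fin 4)), 1 ≤ ptuW a L p y) ∧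
      (∀ y : (Fin p → EuclideanSpace ℝ (Fin 4)), 0 ≤ ptuNear a p y ∧ ptuNear a p y ≤ 1) ∧
      (∀ y : (Fin p → EuclideanSpace ℝ (Fin 4)), 0 ≤ ptuOut a L p y ∧ ptuOut a L p y ≤ 1) ∧
      (∀ (m : ℕ) (v : Fin 4 → ℤ) (z : Fin p → Fin 4 → ℤ) (y : (Fin p → EuclideanSpace ℝ (Fin 4))),
        0 ≤ ptuPhiStar a m p v z y ∧ ptuPhiStar a m p v z y ≤ 1) ∧
      (∀ y : (Fin p → EuclideanSpace ℝ (Fin 4)), ptuNear a p y ≠ 0 →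
        ∃ i j : Fin p, i ≠ j ∧ ∀ μ : Fin 4, |y i μ - y j μ| < (ptuR p : ℝ) * a) ∧
      (∀ y : (Fin p → EuclideanSpace ℝ (Fin 4)), ptuOut a L p y ≠ 0 → ∃ (i : Fin p) (μ : Fin 4), a * (L : ℝ) / 8 < |y i μ|) ∧
      (∀ m ∈ ptuLevels L p, LevelAdmissible L m ∧ ptuM0 p ≤ m ∧ 32 ≤ ptuD m p ∧
        ∀ vz ∈ ptuIdx L m p,
          (∀ i : Fin p, CellInHalfBox L m vz.1 (vz.2 i)) ∧ Function.Injective vz.2 ∧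
          (∀ i : Fin p, tsupport (ptuChiFun a m p vz.1 (vz.2 i)) ⊆ physCore a m vz.1 (vz.2 i)) ∧
          (∀ (i : Fin p) (u : EuclideanSpace ℝ (Fin 4)), u ∈ tsupport (ptuChiFun a m p vz.1 (vz.2 i)) →
            ptuChiTildeFun a m p vz.1 (vz.2 i) u = 1) ∧
          (∀ y : (Fin p → EuclideanSpace ℝ (Fin 4)), y ∈ tsupport (ptuPhiTilde a m p vz.1 vz.2) →
            (∃ i j : Fin p, i ≠ j ∧ ‖y i - y j‖ ≤ 240 * (a * cellSide m)) ∧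
            ∀ (i : Fin p) (μ : Fin 4), a * ((vz.1 μ : ℝ) + cellSide m * (vz.2 i μ : ℝ)) ≤ y i μ ∧
              y i μ ≤ a * ((vz.1 μ : ℝ) + cellSide m * ((vz.2 i μ : ℝ) + 1)))) ∧
      (∀ m ∈ ptuLevels L p, ∀ g : (Fin 4 → ℤ) × (Fin p → Fin 4 → ℤ) → (Fin p → EuclideanSpace ℝ (Fin 4)),
        (∀ vz ∈ ptuIdx L m p, ∀ (i : Fin p) (μ : Fin 4),
          a * ((vz.1 μ : ℝ) + cellSide m * (vz.2 i μ : ℝ)) ≤ g vz i μ ∧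
            g vz i μ ≤ a * ((vz.1 μ : ℝ) + cellSide m * ((vz.2 i μ : ℝ) + 1))) →
        ∑ vz ∈ ptuIdx L m p, (((1 + ‖g vz‖) ^ 6)⁻¹) ^ p ≤
          (2 * (p : ℝ) + 1) ^ 4 * (c * max 1 ((a * cellSide m)⁻¹ ^ 4)) ^ p)) →
    (∃ c : ℝ, 0 < c ∧ ∀ (a : ℝ) (L p : ℕ), 0 < a → IsTriadic L → 1 ≤ L → 2 ≤ p →
      (∀ y : (Fin p → EuclideanSpace ℝ (Fin 4)), 1 ≤ ptuW a L p y) →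
      ContDiff ℝ ∞ (ptuW a L p) ∧
      ∀ m ∈ ptuLevels L p, ∀ vz ∈ ptuIdx L m p,
        ContDiff ℝ ∞ (ptuWeight a L p m vz.1 vz.2) ∧ HasCompactSupport (ptuWeight a L p m vz.1 vz.2) ∧
        tsupport (ptuWeight a L p m vz.1 vz.2) ⊆ tsupport (ptuPhiTilde a m p vz.1 vz.2) ∧
        (∀ (i : Fin p) (j : ℕ) (u : EuclideanSpace ℝ (Fin 4)),
          (a * cellSide m) ^ j * ‖iteratedFDeriv ℝ j (ptuChiFun a m p vz.1 (vz.2 i)) u‖ ≤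
            c * (c * ((p : ℝ) + 1) * ((j : ℝ) + 1) ^ 4) ^ j) ∧
        (∀ (n : ℕ) (y : (Fin p → EuclideanSpace ℝ (Fin 4))),
          ‖iteratedFDeriv ℝ n (ptuWeight a L p m vz.1 vz.2) y‖ ≤
            c * (c * ((p : ℝ) + 1) ^ 8 * ((n : ℝ) + 1) ^ 8 / (a * cellSide m)) ^ n)) →
    ((∀ (p n M K : ℕ) (F : 𝓢((Fin p → EuclideanSpace ℝ (Fin 4)), ℂ)), IsOffDiagonal F →
        ∀ (w : (Fin p → EuclideanSpace ℝ (Fin 4)) → ℝ) (A D δ d : ℝ), ContDiff ℝ ∞ w → HasCompactSupport w →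
          0 ≤ A → 0 ≤ D → 0 ≤ δ → 0 ≤ d →
          (∀ i ≤ n, ∀ y : (Fin p → EuclideanSpace ℝ (Fin 4)), ‖iteratedFDeriv ℝ i w y‖ ≤ A * D ^ i) →
          (∀ y ∈ tsupport w, ∃ i j : Fin p, i ≠ j ∧ ‖y i - y j‖ ≤ δ) →
          (∀ y ∈ tsupport w, d ≤ ‖y‖) →
          schwartzNorm n (SchwartzMap.smulLeftCLM ℂ (fun y : (Fin p → EuclideanSpace ℝ (Fin 4)) => ((w y : ℝ) : ℂ)) F) ≤
            A * (2 * max 1 D) ^ n * 2 ^ (K + 1) * δ ^ M * ((1 + d) ^ K)⁻¹ * schwartzNorm (n + M + K) F) ∧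
      (∃ c : ℝ, 0 < c ∧ ∀ (N p : ℕ) (a : ℝ) (L : ℕ) (F : 𝓢((Fin p → EuclideanSpace ℝ (Fin 4)), ℂ)),
        0 < a → a ≤ 1 → a⁻¹ ≤ (a * L) ^ N →
        ∑ x ∈ (Finset.univ : Finset (Fin p → ↥(box 4 L))).filter
            (fun x => ∃ (i : Fin p) (μ : Fin 4), (L : ℝ) < 8 * |(((x i : Site 4) μ : ℤ) : ℝ)|),
          ‖F (fun i => a • siteToE (↑(x i) : Site 4))‖ ≤
          (c * 2 ^ (16 * N)) ^ (p + 1) * schwartzNorm (p * (4 * N + 6)) F)) →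
    ∀ (G : Type) [Group G] [TopologicalSpace G] [IsTopologicalGroup G] [CompactSpace G]
      [MeasurableSpace G] [BorelSpace G] (r : LatticeRep G) (sch : SpeciesScheme (YMSpecies G)),
      PolyVolumeGrowth sch → ProductBound r sch → UUVB r sch := by
  intro hGeo hDer hAna G _ _ _ _ _ _ r sch hPVG hPB
  obtain ⟨N₁, -, hev⟩ := hPVG
  obtain ⟨C, p₀, s, k₀, hC, hPBk⟩ := hPB
  obtain ⟨s', Ω, E, hΩ1, hunif⟩ := ptuAsm_uniform hGeo hDer hAna r sch (N₁ := N₁) hC hPBk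
  refine ⟨s', Ω * Real.exp Ω * (2 * Real.exp 1) ^ E * Real.exp ((2 * Real.exp 1) ^ E), ((E + 2 : ℕ) : ℝ), ?_⟩
  -- eventually `a_k ≤ 1` and `L_k ≥ 1`
  have ha1 : ∀ᶠ k in atTop, sch.a k ≤ 1 :=
    (sch.tendsto_a.eventually (eventually_lt_nhds one_pos)).mono fun k hk => hk.le
  have haL : ∀ᶠ k in atTop, 1 ≤ sch.a k * (sch.L k : ℝ) := tendsto_atTop.1 sch.tendsto_L 1
  filter_upwards [eventually_ge_atTop k₀, ha1, haL, hev] with k hk hak hL hvol p q F hF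
  have ha : 0 < sch.a k := sch.a_pos k
  have hL1 : 1 ≤ sch.L k := by
    have h1 := mul_le_mul_of_nonneg_right hak (Nat.cast_nonneg (sch.L k) : (0 : ℝ) ≤ sch.L k)
    have h : (1 : ℝ) ≤ (sch.L k : ℝ) := by linarith
    exact_mod_cast h
  refine (hunif k hk hL1 hak hvol p q F hF).trans ?_
  rw [Real.rpow_natCast]
  exact mul_le_mul_of_nonneg_right (ptuKit_shape_le_factorial Ω E p hΩ1) (schwartzNorm_nonneg _ _)

end Summit.QuantumFields.YangMills.Theorems.ContinuumLegGivenGap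

end
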